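import Summits.AtomisticToContinuum.FouriersLaw.Theses.CageBudgetFekete
import Summits.AtomisticToContinuum.FouriersLaw.Theorems.UnboundedHeatVariance.Negative.LoadBearing
import Summits.AtomisticToContinuum.FouriersLaw.Theorems.UnboundedHeatVariance.Negative.AbstractCage
import Summits.AtomisticToContinuum.FouriersLaw.Theorems.UnboundedHeatVariance.Negative.BirthNecessity
import Summits.AtomisticToContinuum.FouriersLaw.Theorems.UnboundedHeatVariance.Negative.LacunaryCage
import Literature.MathematicalPhysics.KineticTheory.InfiniteChainAbelWitness

/-!
# Disproof of `UnboundedHeatVariance` (U) — findings of the crux disprover (cycle 1, 2026-08-17)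

Crux `Summit.AtomisticToContinuum.FouriersLaw.Theses.CageBudgetFekete.UnboundedHeatVariance`
(item `stmt-AtomisticToContinuum-15771`, route CageBudgetFekete, rank 4; picked line `birth`). U: for
`pinnedChain ω₂ lam β γ` (`ω₂, lam, β > 0`), `T > 0`, every shift- and momentum-reversal-invariant DLR state `μ`
and every `μ`-preserving, shift-covariant `InfiniteChainDynamics D` with absolutely convergent, continuous summed
current autocorrelation `C`, the heat variance `V(τ) = 2∫_{(0,τ]}(τ-s)C(s)ds` satisfies `∀ R ∃ τ ≥ 0, R < V τ`.

VERDICT OF THIS CYCLE: **no kill; U resists SUBSTANTIVELY, not for lack of attacks.** Index of findings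
(everything conclusive is LANDED and imported above; this file adds read-backs, the reduction under Q, and the
prose census of what was tried):

* §0 `conclusion_iff_not_bddAbove` — read-back: U's conclusion for a given `V` is `¬ BddAbove (V '' Ici 0)`.
* §A LOAD-BEARING HYPOTHESES (landed, Negative (1) `LoadBearing.lean`, p145361, refuter-rattack):
  `unboundedHeatVariance_false_without_carrierAE` (drop "μ-a.e. in the carrier": frozen junk flow `id` or
  `momentumReversalZ` on carrier `∅` gives `C ≡ ∓c₀`, `V ≤ 0`) and `unboundedHeatVariance_false_without_gibbs`
  (DLR weakened to probability: Dirac at rest + rest dynamics, `C ≡ 0`). Used here: cited, not repeated. The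
  remaining hypotheses (shift/reversal invariance of `μ`, a.e. shift-covariance, absolute convergence,
  continuity of `C`, `0 < T`, the parameter guards) CANNOT be shown load-bearing by a model: every model of the
  guard needs a genuine `μ`-preserving solution flow of the infinite chain (unconstructed: SymmetricSetup,
  stmt-11036), and in the degenerate corners that ARE decidable the statement is true or vacuous (`T ≤ 0`: no DLR
  state since the finite-volume normaliser diverges and `Measure.tilted` returns `0`; `lam < 0`/`β < 0`: same;
  harmonic `lam = β = 0`: `V = C(0)τ²`, U true; unpinned: true). Mutation notes for provers: reversal
  invariance is automatic for the unique regular DLR state (`stub_regularDLRUnique`, landed) — possibly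
  unnecessary; `Continuous C` is what Bochner (line `birth` S1) consumes and is NOT derivable from the structure
  (no joint measurability of `(t, σ) ↦ flow t σ` is a field).
* §B THE ABSTRACT CAGE (landed, Negative (2) `AbstractCage.lean`, p161033, this seat): closed-form kernel
  `∫_{(0,τ]}(τ-s)cos(ωs)ds = (1-cos ωτ)/ω²`; Fubini `V_ρ(τ) = ∫ 2∫(τ-s)cos(ωs)ds dρ`; the ABSTRACT INSULATOR
  `spectralHeatVariance_le_of_integrable_inv_sq` (no atom at `0` ∧ `(ω²)⁻¹ ∈ L¹(ρ)` ⇒ `V ≤ 4∫(ω²)⁻¹dρ`; exact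
  converse of `birth` S3, so S3's infrared hypothesis is NECESSARY); `birth` S3 is false without its infrared
  clause (`ρ = δ₁`) and without `IsFiniteMeasure ρ` (`ρ = ∞•δ₁`, Bochner junk); and
  `not_unboundedHeatVariance_of_abstract_frame`: the kernel `C = cos` is continuous, even, of positive type,
  `C(0) = 1 > 0`, `|C| ≤ C(0)`, has `V = 2(1 - cos τ) ∈ [0,4]`, satisfies the route's crux Q with cage budget
  `K = 8` and crux C with `B = 1` — and violates U. HENCE: U is independent of Q, C, HeatVarianceCalculus and
  Bochner positivity together; any proof needs a zero-frequency input specific to the chain.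
* §C REDUCTION UNDER Q (this file, `unbounded_of_quasiSuperadditive_of_exceeds`,
  `quasiSuperadditive_unbounded_iff_exceeds_budget`): under the route's crux Q with budget `K`, U is EQUIVALENT to
  the FINITE-TIME certificate `∃ τ ≥ 0, K < V τ` (iterate `V((n+1)τ) ≥ V(nτ) + V(τ) - K`). The glue `closes`
  uses U exactly once, at `R = K + 1`. Planner note: inside THIS route U may be replaced by the weaker,
  MD-certifiable "the heat variance eventually exceeds its own cage budget" (StaticTwoMomentCertificate of the
  route header: `V(τ) ≥ C(0)τ² - c₂τ⁴/12` gives it whenever `K < 3C(0)²/c₂`); outside Q the two are different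
  (the `cos` cage has `sup V = 4 < K = 8`).
* §D LINE `birth` (picked 2026-08-17): joint sufficiency is kernel-checked by the lead; negative audit of the
  stubs: S1 (Bochner) true on paper (positive type of the SUMMED correlation follows from `HasAbsConvergentCorrelation`
  at `t = 0` giving `j₀ ∈ L²`, measure preservation, a.e. group law, shift invariance + covariance, Fejér); S3
  true and TIGHT (§B); S2 is NECESSARY for U — `stub_infraredCurrentSpectrum_of_unboundedHeatVariance`
  (U ⟹ S2 verbatim, via §B; LANDED as Negative (3) `BirthNecessity.lean`, p161493) — so S2 ⟺ U modulo S1+S3: the line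
  neither loses nor smuggles strength. No stub is false; no `-- Targets` kill.
* §D' NATURAL STRENGTHENINGS OF THE CONCLUSION ARE FALSE AT THE SPECTRAL LEVEL (landed, Negative (4)
  `LacunaryCage.lean`): the lacunary spectral measure `ρ = Σₙ 4⁻ⁿ δ_{2⁻ⁿ}` is finite and infrared-charged
  (`∫ω⁻²dρ = ∞`, so `birth` S3 gives `sup V = ∞`), yet `V(2^N·2π) ≤ 22` for every `N`
  (`lacunary_heatVariance_dyadic_le`): `not_tendsto_atTop_of_infrared` (¬ `V → ∞`) and
  `not_linear_lower_envelope_of_infrared` (¬ `cτ ≤ V(τ)` eventually). U's `sup` form is exactly what the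
  spectral alternative supports; `V → ∞` / `liminf V/τ > 0` (CoercivePulse's Nash envelope) are strictly stronger
  restatements that the Cesàro–Fatou line cannot deliver.
* §E WHY U RESISTS (census of the negation attempt). A counterexample is ONE guarded `(μ, D)` of the clean
  pinned quartic chain with ONE finite representing measure of insulating type (§B/§D), i.e. `[J] = L u`,
  `u ∈ ℋ₀` — a normalisable energy POLARISATION, which requires every energy packet to stay caged for all
  times: classical many-body localisation in a CLEAN chain at `T > 0`. (i) The only insulating oscillator
  chains in print are DISORDERED and HARMONIC (Anderson: AjankiHuveneers2011, Bernardin–Huveneers; excluded by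
  translation invariance of `pinnedChain`) — De Roeck–Huveneers themselves (arXiv:1409.8054 = doi
  10.1007/978-3-319-16637-7_5, p.3) call the disordered harmonic chain "a well known example of perfect thermal
  insulator" and argue that in TRANSLATION-INVARIANT short-range systems "rare mobile thermal bubbles … seem to
  be unavoidable", so that "there is no MBL phase at all (except possibly at zero temperature) in the true
  thermodynamic limit", while (p.4) "asymptotic localization effects are surely expected … predicting a
  non-analytic behavior of the thermal conductivity near the (trivial) critical point" — i.e. `κ > 0` but
  smaller than any power: U TRUE with an invisible rate. (ii) DeRoeckHuveneers2015 (arXiv:1305.5127) Thms 1–2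
  make `[J]` a coboundary ORDER BY ORDER (`εJ = L_H U_n + O(ε^{n+1})`) in the anticontinuum scaling; the series
  is asymptotic, no fixed admissible parameter is shown insulating; inside the admissible open set
  (`ω₂, lam, β, T > 0`, any `γ`) the DRH corner is `β ↓ 0`, `lam·T → ∞` (the harmonic part of the coupling
  `r²/2` has FIXED unit strength, so `T → ∞` at fixed `lam, β` is NOT weak coupling: `βr⁴ ≍ (β/lam)·lam q⁴`).
  (iii) Numerics. On file (kit j024493, ring `N = 256`, 16 Gibbs samples, planner-cstrat): no plateau of `V_N`
  up to `τ = 660, 330, 330, 211` at `(ω₂,lam,β,T) = (1,1,1,1), (1,1,1,10), (1,10,1,10), (1,10,1,100)`,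
  last-window growth `V_N ~ τ^{1.14, 1.19, 0.75, 0.88}`; φ⁴ literature `κ ≈ 2.83 T^{-1.35}` (Aoki–Kusnezov
  2000). THIS SEAT (kit j026176, `mdjob/main.py`, ring `N = 160`, `M = 32` Gibbs samples by Langevin, NVE
  velocity-Verlet `t_prod = 640`, energy drift `≤ 1.1·10⁻⁴`, time-origin averaged `V_N(τ)`, `τ ≤ 320`) walked DOWN
  the De Roeck–Huveneers weak-coupling ladder `g := 1/(ω₂ + 3lam⟨q²⟩)` inside the admissible set:
  `(ω₂,lam,β,T; g)` = `(1,1,1,1; 0.56)`, `(1,10,1,100; 0.019)`, `(1,10,0.01,10; 0.053)`, `(1,10,0.01,100; 0.016)`,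
  `(1,100,0.01,100; 0.0048)`. Plateau indicator `V(320)/max_{τ≤80}V` (4 = diffusive, 1 = caged, 16 = ballistic):
  `8.1, 3.2, 3.1, 2.0, 1.45`; last-decade log-slopes `≈ 1.3–1.4, 0.5–0.9, 0.7–1.1, 0.4–0.6, 0.1–0.36`. In the two
  deepest cases the CAGE is visible as a genuine DIP of `V` (anticorrelated heat increments — the Q-crux's defect):
  `(1,10,0.01,100)`: `V = 503 (τ=5.5) → 448 (τ=9) → 1911 (τ=320)`; `(1,100,0.01,100)`: `V = 81.4 (τ=5.5) → 53.8
  (τ=9)`, oscillating in `[58, 76]` until `τ ≈ 37`, then creeping `84.5, 90.1, 91.8, 97.0, 98.8, 104.1, 112.6,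
  122.7, 133.0 (±19)` at `τ = 47 … 320` — quasi-caged over 1.8 decades (`V/τ` falls from `20` to `0.42`) but still
  rising monotonically at the end (growth `81 → 133`, ≈ 2σ per step, systematic). So: NO numerical plateau
  anywhere (U not contradicted), AND a quantitative picture of why U is 'true with an invisible rate' in the DRH
  corner. Observed first-dip cage defects `D(s,s) = 2V(s) - V(2s)` at `s ≈ 5` (a lower bound for the Q-crux budget
  `K_T`), relative to `V(2s)`: `< 0` at `g = 0.56` (convex, ballistic onset), `0.13` at `(1,10,1,100)`, `0.5` at
  `g = 0.053`, `1.0` at `g = 0.016` (`K_obs ≈ 511`, the §C certificate `V > K_obs` reached at `τ* ≈ 40`), `2.0` at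
  `g = 0.0048` (`K_obs ≈ 105` against `sup_{τ≤320} V = 133`: the certificate is only just reached inside the
  window, `τ* ≈ 200–320`). The cage deepens monotonically down the ladder; nothing saturates. (iv) Junk counterexamples are all excluded (§A). (v) No barrier of
  `Literature/Barriers/AtomisticToContinuum/` produces an insulating clean state (DeRoeckHuveneers2015_thm2 is
  asymptotic; AjankiHuveneers2011_scaling needs disorder; Mazur/harmonic barriers make U TRUE).
  Obstruction in one line: "nobody can build, or rule out, classical clean MBL at positive temperature" — an
  absence of constructions, not a lemma; its positive shadow is exactly `birth` S2 / `relay` S3.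

What a prover should take from this file: U cannot come from the frame, from Q, from C, or from positivity of
`C(0)` (§B); under Q it is a finite-time statement (§C); in spectral form it is `A(ν)/ν = ∫dρ/(ν²+ω²) → ∞`
(S2), strictly weaker than `κ > 0`.

refuter-cdisprove-stmt-AtomisticToContinuum-15771-0. Prose only in docstrings; every `theorem` below is
sorry-free.
-/

noncomputable section

namespace Summit.AtomisticToContinuum.FouriersLaw.Cruxes.UnboundedHeatVariance.Disproof

open MeasureTheory Set Filter Topology
open Literature.MathematicalPhysics.KineticTheory.HeatConduction
open Summit.AtomisticToContinuum.FouriersLaw.Theses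
open Summit.AtomisticToContinuum.FouriersLaw.Theorems.UnboundedHeatVariance.Negative

/-! ## §0 Read-back -/

/-- U's conclusion for a fixed `V` says exactly that `V` is unbounded above on `[0, ∞)`. [folklore] -/
theorem conclusion_iff_not_bddAbove (V : ℝ → ℝ) :
    (∀ R : ℝ, ∃ τ : ℝ, 0 ≤ τ ∧ R < V τ) ↔ ¬ BddAbove (V '' Ici 0) := by
  constructor
  · rintro h ⟨M, hM⟩
    obtain ⟨τ, hτ, hlt⟩ := h M
    exact absurd (hM ⟨τ, hτ, rfl⟩) (not_le.2 hlt)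
  · intro h R
    by_contra hc
    push Not at hc
    exact h ⟨R, by rintro _ ⟨τ, hτ, rfl⟩; exact hc τ hτ⟩

/-! ## §A Load-bearing hypotheses — landed in `Negative/LoadBearing.lean` (p145361); pointers only -/

/-- Pointer (no new content): the a.e.-carrier clause of `PreservesMeasure` is load-bearing
(`Negative.unboundedHeatVariance_false_without_carrierAE`) and so is the DLR property
(`Negative.unboundedHeatVariance_false_without_gibbs`). [folklore] -/
theorem loadBearing_pointers :
    (¬ (∀ ω₂ lam β γ : ℝ, 0 < ω₂ → 0 < lam → 0 < β → ∀ T : ℝ, 0 < T →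
        ∀ μ : MeasureTheory.Measure ChainConfig,
          IsProbabilityMeasure μ → IsShiftInvariant μ →
          μ.map (fun σ : ChainConfig => fun x : ℤ => ((σ x).1, -(σ x).2)) = μ →
          ∀ D : InfiniteChainDynamics (pinnedChain ω₂ lam β γ),
            D.PreservesMeasure μ →
            (∀ t : ℝ, ∀ᵐ σ ∂μ, D.flow t (shift σ) = shift (D.flow t σ)) →
            (∀ t : ℝ, D.HasAbsConvergentCorrelation μ t) →
            Continuous (fun t : ℝ => D.currentCorrelation μ t) →
            ∀ V : ℝ → ℝ, V = (fun τ : ℝ => 2 * ∫ s in Set.Ioc (0:ℝ) τ, (τ - s) * D.currentCorrelation μ s) →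
              ∀ R : ℝ, ∃ τ : ℝ, 0 ≤ τ ∧ R < V τ)) :=
  unboundedHeatVariance_false_without_gibbs

/-! ## §B The abstract cage — landed in `Negative/AbstractCage.lean` (p161033); one corollary spelled out -/

/-- The `cos` cage in one line: a continuous positive-type kernel with `C(0) > 0` whose heat variance is
bounded by `4` (instance of `spectralHeatVariance_dirac_one`). [folklore] -/
theorem cos_cage_bounded (τ : ℝ) :
    2 * ∫ s in Ioc (0:ℝ) τ, (τ - s) * Real.cos s ≤ 4 := by
  rcases lt_or_ge τ 0 with hτ | hτ
  · rw [Ioc_eq_empty (not_lt.2 hτ.le), Measure.restrict_empty, integral_zero_measure, mul_zero]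
    norm_num
  · have h := integral_Ioc_sub_mul_cos one_ne_zero hτ
    simp only [one_mul, one_pow, div_one] at h
    rw [h]
    linarith [Real.neg_one_le_cos τ]

/-! ## §C Reduction under the cage budget Q: U is a finite-time certificate -/

/-- **Fekete-with-defect, lower iteration.** If `V(s) + V(t) ≤ V(s+t) + K` for `s, t ≥ 0`, then
`n (V τ - K) + K ≤ V (n τ)` for every `n ≥ 1`, `τ ≥ 0`. [folklore] -/
theorem iterate_quasiSuperadditive {V : ℝ → ℝ} {K : ℝ}
    (hQ : ∀ s t : ℝ, 0 ≤ s → 0 ≤ t → V s + V t ≤ V (s + t) + K) {τ : ℝ} (hτ : 0 ≤ τ) :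
    ∀ n : ℕ, 1 ≤ n → (n : ℝ) * (V τ - K) + K ≤ V ((n : ℝ) * τ) := by
  intro n hn
  induction n with
  | zero => exact absurd hn (by norm_num)
  | succ m ih =>
    rcases Nat.eq_zero_or_pos m with rfl | hm
    · simp
    · have ih' := ih hm
      have h1 := hQ ((m : ℝ) * τ) τ (by positivity) hτ
      push_cast
      rw [show ((m : ℝ) + 1) * τ = (m : ℝ) * τ + τ by ring]
      linarith

/-- **Under Q, exceeding the budget once gives U's conclusion.** If `V` is quasi-superadditive with budget `K`
on `[0,∞)` and `K < V τ₀` for one `τ₀ ≥ 0`, then `V` is unbounded above on `[0,∞)`. This is the only way the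
route's glue `closes` uses U (at `R = K + 1`). [folklore] -/
theorem unbounded_of_quasiSuperadditive_of_exceeds {V : ℝ → ℝ} {K : ℝ}
    (hQ : ∀ s t : ℝ, 0 ≤ s → 0 ≤ t → V s + V t ≤ V (s + t) + K)
    {τ₀ : ℝ} (hτ₀ : 0 ≤ τ₀) (hex : K < V τ₀) :
    ∀ R : ℝ, ∃ τ : ℝ, 0 ≤ τ ∧ R < V τ := by
  intro R
  obtain ⟨n, hn⟩ := exists_nat_gt (max ((R - K) / (V τ₀ - K)) 1)
  have hn1 : (1 : ℝ) < n := (le_max_right _ _).trans_lt hn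
  have hnR : (R - K) / (V τ₀ - K) < n := (le_max_left _ _).trans_lt hn
  have hpos : 0 < V τ₀ - K := sub_pos.2 hex
  refine ⟨(n : ℝ) * τ₀, by positivity, ?_⟩
  have hit := iterate_quasiSuperadditive hQ hτ₀ n (by exact_mod_cast hn1.le)
  rw [div_lt_iff₀ hpos] at hnR
  linarith

/-- **Under Q, U ⟺ "the heat variance exceeds its cage budget once".** (The forward direction is trivial.)
Inside route CageBudgetFekete the unboundedness crux may therefore be replaced by a finite-time, MD-certifiable
statement; outside Q the two differ (the `cos` cage: `sup V = 4`). [folklore] -/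
theorem quasiSuperadditive_unbounded_iff_exceeds_budget {V : ℝ → ℝ} {K : ℝ}
    (hQ : ∀ s t : ℝ, 0 ≤ s → 0 ≤ t → V s + V t ≤ V (s + t) + K) :
    (∀ R : ℝ, ∃ τ : ℝ, 0 ≤ τ ∧ R < V τ) ↔ ∃ τ₀ : ℝ, 0 ≤ τ₀ ∧ K < V τ₀ :=
  ⟨fun h => h K, fun ⟨_, hτ₀, hex⟩ => unbounded_of_quasiSuperadditive_of_exceeds hQ hτ₀ hex⟩

/-! ## §D Line `birth` — negative audit of the stubs (see `Negative/BirthNecessity.lean` for U ⟹ S2)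

Nothing to kill: S1 true on paper, S3 true and tight (`Negative.spectralHeatVariance_le_of_integrable_inv_sq`,
`Negative.stub_spectralHeatVarianceUnbounded_false_without_infrared`,
`Negative.stub_spectralHeatVarianceUnbounded_false_without_finite`), S2 necessary (U ⟹ S2). The corollary
below records, in the line's vocabulary, the exact shape a counterexample to U must have. -/

/-- **Shape of any counterexample (abstract insulator, contrapositive form).** If a kernel `C` is represented on
`t ≥ 0` by a finite measure with no atom at `0` and integrable `(ω²)⁻¹`, its heat variance is bounded by
`4∫(ω²)⁻¹dρ` — so U fails for that `C`. A disproof of U must therefore exhibit a guarded `(μ, D)` of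
`pinnedChain` whose summed current autocorrelation is of this type (`[J]` an exact `ℋ₀`-coboundary). [folklore] -/
theorem heatVariance_bounded_of_insulating_representation (C : ℝ → ℝ) (ρ : Measure ℝ) [IsFiniteMeasure ρ]
    (hrep : ∀ t : ℝ, 0 ≤ t → C t = ∫ w, Real.cos (w * t) ∂ρ)
    (h0 : ρ {0} = 0) (hint : Integrable (fun w : ℝ => (w ^ 2)⁻¹) ρ) (τ : ℝ) :
    2 * ∫ s in Ioc (0:ℝ) τ, (τ - s) * C s ≤ 4 * ∫ w, (w ^ 2)⁻¹ ∂ρ := by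
  have hEq : (2 * ∫ s in Ioc (0:ℝ) τ, (τ - s) * C s)
      = 2 * ∫ s in Ioc (0:ℝ) τ, (τ - s) * ∫ w, Real.cos (w * s) ∂ρ := by
    congr 1
    refine setIntegral_congr_fun measurableSet_Ioc fun s hs => ?_
    rw [hrep s hs.1.le]
  rw [hEq]
  exact spectralHeatVariance_le_of_integrable_inv_sq ρ h0 hint τ

/-! ## §E Hypothesis minimality and near-misses (none sorried) -/

/-- The temperature guard `0 < T` of U is implied by its DLR hypothesis (tree fact, re-exported for the
provers' briefing): not load-bearing. [folklore] -/
theorem temp_guard_redundant {ω₂ lam β γ T : ℝ} (hω : 0 < ω₂) (hl : 0 < lam) (hβ : 0 < β)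
    {μ : Measure ChainConfig} (hG : (pinnedChain ω₂ lam β γ).IsChainGibbsMeasure T μ) : 0 < T :=
  isChainGibbsMeasure_pinnedChain_temp_pos hω.le hl.le hβ.le hG

/-!

* `0 < T` is REDUNDANT given `IsChainGibbsMeasure T μ` for `pinnedChain` — already in the tree:
  `Literature…InfiniteChainAbelWitness.isChainGibbsMeasure_pinnedChain_temp_pos` (normaliser of the one-site
  finite-volume distribution diverges for `T ≤ 0`, `Measure.tilted` returns `0`, DLR forces `μ = 0`); recorded
  below as `temp_guard_redundant` — information for provers only, it changes nothing for U.
* "sup = ∞" versus "V → ∞": settled abstractly in Negative (4) (`LacunaryCage.lean`): different. U and `birth` S3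
  are both in the weaker `sup` form, consistently; see `lacunary_pointer` below.
-/

/-- Pointer (landed content, Negative (4)): infrared charge of a finite spectral measure does not force the heat
variance to tend to infinity. [folklore] -/
theorem lacunary_pointer :
    ¬ (∀ ρ : MeasureTheory.Measure ℝ, MeasureTheory.IsFiniteMeasure ρ →
        (0 < ρ {0} ∨ ¬ MeasureTheory.Integrable (fun w : ℝ => (w ^ 2)⁻¹) ρ) →
        Tendsto (fun τ : ℝ => 2 * ∫ s in Set.Ioc (0:ℝ) τ, (τ - s) * (∫ w : ℝ, Real.cos (w * s) ∂ρ))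
          atTop atTop) :=
  not_tendsto_atTop_of_infrared

end Summit.AtomisticToContinuum.FouriersLaw.Cruxes.UnboundedHeatVariance.Disproof

end
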